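import Mathlib.Analysis.Complex.CauchyIntegral
import Mathlib.MeasureTheory.Integral.CircleIntegral
import Mathlib.MeasureTheory.Integral.IntervalIntegral.IntegrationByParts
import HarnessLib

/-!
# Radius change for right half-arc integrals: the annular-sector Cauchy theorem

RH ladder column JENSEN, rung J-P(P3) «log band», BAND crux `XiDerivBandRealAllRates` of route
«JensenLogBand», line «band-one-window» (u-arc reshape), lead rh-jensen-prover g7 — infrastructure
lemma (S2) of HOME/rh-jensen-prover/g7-work/LINE-PLAN.md. RH-FREE generic complex analysis. WHAT THIS
IS NOT: nothing here bears on zeros of `ζ` or the truth of RH.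

**Why.** The right half-arc transform `U_{n,h}(v)` of the BAND line (`LogBandArc.xiSqArcU`,
`Theorems/JensenLogBandArcTransform.lean`) is DEFINED with the common radius `h = h(n,T)`, but must be
ANALYSED on the circle through the saddle point of its integrand (the fixed radius misses the saddle
by many Gaussian widths at the bottom of the band). The two half-arc integrals differ only by the
integrals over the two short vertical segments at the arc ends, where the integrand is exponentially
small:

  `∫_{right arc, radius h₁} f − ∫_{right arc, radius h₂} f = i ∫_{h₂}^{h₁} (f(c + ir) + f(c − ir)) dr`

(`LogBandArc.rightArc_sub_rightArc_eq`, no new definitions), for `f` holomorphic on the closed right half-annulus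
`{h₂ ≤ |u − c| ≤ h₁, Re (u − c) ≥ 0}` — Cauchy's theorem for that region, obtained from Mathlib's
rectangle theorem (`Complex.integral_boundary_rect_eq_zero_of_differentiableOn`) applied to
`ζ ↦ f(c + e^ζ) e^ζ` on `[log h₂, log h₁] × [−π/2, π/2]`, plus the substitution `r = e^x` on the
horizontal sides.
-/

noncomputable section

-- single-problem summit: `Summit.RiemannHypothesis.RiemannHypothesis.…` is the tree convention
set_option linter.dupNamespace false

open Complex Real MeasureTheory intervalIntegral Set Metric

namespace Summit.RiemannHypothesis.RiemannHypothesis.Theorems.JensenPolynomials.LogBandArc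

/-- The exponential chart: `ζ ↦ c + e^ζ` maps the rectangle `[log h₂, log h₁] × [−π/2, π/2]` into
the closed right half-annulus. [folklore] -/
theorem add_exp_mem_rightHalfAnnulus {c ζ : ℂ} {h₂ h₁ : ℝ} (hh₂ : 0 < h₂)
    (hre : ζ.re ∈ uIcc (Real.log h₂) (Real.log h₁)) (hle : h₂ ≤ h₁)
    (him : ζ.im ∈ uIcc (-(π / 2)) (π / 2)) :
    h₂ ≤ ‖c + cexp ζ - c‖ ∧ ‖c + cexp ζ - c‖ ≤ h₁ ∧ 0 ≤ (c + cexp ζ - c).re := by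
  have hh₁ : 0 < h₁ := lt_of_lt_of_le hh₂ hle
  rw [uIcc_of_le (Real.log_le_log hh₂ hle)] at hre
  rw [uIcc_of_le (by linarith [Real.pi_pos] : -(π / 2) ≤ π / 2)] at him
  simp only [add_sub_cancel_left, Complex.norm_exp, Complex.exp_re]
  refine ⟨?_, ?_, ?_⟩
  · calc h₂ = Real.exp (Real.log h₂) := (Real.exp_log hh₂).symm
      _ ≤ Real.exp ζ.re := Real.exp_le_exp.2 hre.1
  · calc Real.exp ζ.re ≤ Real.exp (Real.log h₁) := Real.exp_le_exp.2 hre.2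
      _ = h₁ := Real.exp_log hh₁
  · exact mul_nonneg (Real.exp_pos _).le (Real.cos_nonneg_of_mem_Icc ⟨him.1, him.2⟩)

/-- A horizontal side of the rectangle in the exponential chart is a vertical segment integral:
`∫_{log h₂}^{log h₁} f(c + e^{x} e^{iy₀}) e^{x} e^{iy₀} dx = ∫_{h₂}^{h₁} f(c + r e^{iy₀}) e^{iy₀} dr`
(substitution `r = e^x`). [folklore] -/
theorem integral_exp_chart_horizontal (f : ℂ → ℂ) (c : ℂ) (y₀ : ℝ) {h₂ h₁ : ℝ} (hh₂ : 0 < h₂)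
    (hh₁ : 0 < h₁) :
    (∫ x in Real.log h₂..Real.log h₁, f (c + cexp ((x : ℂ) + (y₀ : ℂ) * I)) *
        cexp ((x : ℂ) + (y₀ : ℂ) * I)) =
      ∫ r in h₂..h₁, f (c + (r : ℂ) * cexp ((y₀ : ℂ) * I)) * cexp ((y₀ : ℂ) * I) := by
  set g : ℝ → ℂ := fun r => f (c + (r : ℂ) * cexp ((y₀ : ℂ) * I)) * cexp ((y₀ : ℂ) * I) with hg
  have hsub := intervalIntegral.integral_deriv_smul_comp_of_deriv_nonneg
    (f := Real.exp) (f' := Real.exp) (g := g) (a := Real.log h₂) (b := Real.log h₁)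
    Real.continuous_exp.continuousOn (fun x _ => Real.hasDerivAt_exp x)
    (fun x _ => (Real.exp_pos x).le)
  rw [Real.exp_log hh₂, Real.exp_log hh₁] at hsub
  rw [← hsub]
  refine intervalIntegral.integral_congr fun x _ => ?_
  simp only [hg, Function.comp_apply, Complex.real_smul, Complex.ofReal_exp, Complex.exp_add]
  ring

/-- **Radius change for right half-arc integrals (annular-sector Cauchy theorem).** If `f` is
complex-differentiable at every point of the closed right half-annulus
`{h₂ ≤ |u − c| ≤ h₁, Re(u − c) ≥ 0}` (`0 < h₂ ≤ h₁`), then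
`rightArc(h₁) − rightArc(h₂) = i ∫_{h₂}^{h₁} (f(c + ir) + f(c − ir)) dr`:
the two half-arc integrals differ by the integrals over the two vertical end segments.
(Cauchy's theorem on the rectangle `[log h₂, log h₁] × [−π/2, π/2]` for `ζ ↦ f(c + e^ζ) e^ζ`.)
[folklore] -/
theorem rightArc_sub_rightArc_eq {f : ℂ → ℂ} {c : ℂ} {h₂ h₁ : ℝ} (hh₂ : 0 < h₂)
    (hle : h₂ ≤ h₁)
    (hf : ∀ u : ℂ, h₂ ≤ ‖u - c‖ → ‖u - c‖ ≤ h₁ → 0 ≤ (u - c).re → DifferentiableAt ℂ f u) :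
    (∫ θ in (-(π / 2))..(π / 2), deriv (circleMap c h₁) θ * f (circleMap c h₁ θ)) -
      (∫ θ in (-(π / 2))..(π / 2), deriv (circleMap c h₂) θ * f (circleMap c h₂ θ)) =
      I * ∫ r in h₂..h₁, (f (c + (r : ℂ) * I) + f (c - (r : ℂ) * I)) := by
  have hh₁ : 0 < h₁ := lt_of_lt_of_le hh₂ hle
  -- the chart function and its differentiability on the rectangle
  set g : ℂ → ℂ := fun ζ => f (c + cexp ζ) * cexp ζ with hg
  set z : ℂ := ((Real.log h₂ : ℝ) : ℂ) + ((-(π / 2) : ℝ) : ℂ) * I with hz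
  set w : ℂ := ((Real.log h₁ : ℝ) : ℂ) + ((π / 2 : ℝ) : ℂ) * I with hw
  have hzre : z.re = Real.log h₂ := by simp [hz]
  have hwre : w.re = Real.log h₁ := by simp [hw]
  have hzim : z.im = -(π / 2) := by simp [hz]
  have hwim : w.im = π / 2 := by simp [hw]
  have hdiff : DifferentiableOn ℂ g (uIcc z.re w.re ×ℂ uIcc z.im w.im) := by
    intro ζ hζ
    rw [hzre, hwre, hzim, hwim] at hζ
    obtain ⟨hm1, hm2, hm3⟩ := add_exp_mem_rightHalfAnnulus (c := c) hh₂ hζ.1 hle hζ.2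
    have h1 : DifferentiableAt ℂ (fun ζ => f (c + cexp ζ)) ζ :=
      (hf _ hm1 hm2 hm3).comp ζ ((differentiableAt_const c).add Complex.differentiableAt_exp)
    exact (h1.mul Complex.differentiableAt_exp).differentiableWithinAt
  have hrect := Complex.integral_boundary_rect_eq_zero_of_differentiableOn g z w hdiff
  rw [hzre, hwre, hzim, hwim] at hrect
  -- vertical sides of the rectangle = the two arcs
  have hvert : ∀ h : ℝ, 0 < h →
      I • (∫ y : ℝ in (-(π / 2))..(π / 2), g (((Real.log h : ℝ) : ℂ) + (y : ℂ) * I)) =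
        ∫ θ in (-(π / 2))..(π / 2), deriv (circleMap c h) θ * f (circleMap c h θ) := by
    intro h hh
    rw [← intervalIntegral.integral_smul]
    refine intervalIntegral.integral_congr fun y _ => ?_
    have hexp : cexp (((Real.log h : ℝ) : ℂ) + (y : ℂ) * I) = (h : ℂ) * cexp ((y : ℂ) * I) := by
      rw [Complex.exp_add, ← Complex.ofReal_exp, Real.exp_log hh]
    simp only [hg, smul_eq_mul, deriv_circleMap, circleMap, hexp, zero_add]
    ring
  -- `e^{±iπ/2} = ±i`
  have hE1 : cexp (((π / 2 : ℝ) : ℂ) * I) = I := by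
    rw [Complex.exp_mul_I]
    push_cast
    rw [Complex.cos_pi_div_two, Complex.sin_pi_div_two]
    ring
  have hE2 : cexp (((-(π / 2) : ℝ) : ℂ) * I) = -I := by
    rw [Complex.exp_mul_I]
    push_cast
    rw [Complex.cos_neg, Complex.sin_neg, Complex.cos_pi_div_two, Complex.sin_pi_div_two]
    ring
  -- horizontal sides of the rectangle = the two vertical end segments
  have hbot : (∫ x : ℝ in Real.log h₂..Real.log h₁, g ((x : ℂ) + ((-(π / 2) : ℝ) : ℂ) * I)) =
      -I * ∫ r in h₂..h₁, f (c - (r : ℂ) * I) := by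
    have := integral_exp_chart_horizontal f c (-(π / 2)) hh₂ hh₁
    simp only [hg]
    rw [this, ← intervalIntegral.integral_const_mul]
    refine intervalIntegral.integral_congr fun r _ => ?_
    simp only [hE2]
    ring_nf
  have htop : (∫ x : ℝ in Real.log h₂..Real.log h₁, g ((x : ℂ) + ((π / 2 : ℝ) : ℂ) * I)) =
      I * ∫ r in h₂..h₁, f (c + (r : ℂ) * I) := by
    have := integral_exp_chart_horizontal f c (π / 2) hh₂ hh₁
    simp only [hg]
    rw [this, ← intervalIntegral.integral_const_mul]
    refine intervalIntegral.integral_congr fun r _ => ?_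
    simp only [hE1]
    ring
  rw [hbot, htop, hvert h₁ hh₁, hvert h₂ hh₂] at hrect
  -- integrability of the two segment integrands (continuity on the segments)
  have hseg : ∀ (ε : ℝ), (ε = 1 ∨ ε = -1) →
      IntervalIntegrable (fun r : ℝ => f (c + (ε : ℂ) * ((r : ℂ) * I))) volume h₂ h₁ := by
    intro ε hε
    refine ContinuousOn.intervalIntegrable ?_
    rw [uIcc_of_le hle]
    intro r hr
    have hr0 : 0 < r := lt_of_lt_of_le hh₂ hr.1
    have hmem : h₂ ≤ ‖c + (ε : ℂ) * ((r : ℂ) * I) - c‖ ∧ ‖c + (ε : ℂ) * ((r : ℂ) * I) - c‖ ≤ h₁ ∧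
        0 ≤ (c + (ε : ℂ) * ((r : ℂ) * I) - c).re := by
      simp only [add_sub_cancel_left, norm_mul, Complex.norm_real, Complex.norm_I, mul_one,
        Real.norm_eq_abs, abs_of_pos hr0]
      rcases hε with h | h <;> subst h <;> norm_num [hr.1, hr.2]
    have hφ : Continuous fun r : ℝ => c + (ε : ℂ) * ((r : ℂ) * I) := by fun_prop
    exact (ContinuousAt.comp (g := f) (f := fun r : ℝ => c + (ε : ℂ) * ((r : ℂ) * I))
      (hf _ hmem.1 hmem.2.1 hmem.2.2).continuousAt hφ.continuousAt).continuousWithinAt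
  have hplus : IntervalIntegrable (fun r : ℝ => f (c + (r : ℂ) * I)) volume h₂ h₁ := by
    simpa using hseg 1 (Or.inl rfl)
  have hminus : IntervalIntegrable (fun r : ℝ => f (c - (r : ℂ) * I)) volume h₂ h₁ := by
    simpa [sub_eq_add_neg] using hseg (-1) (Or.inr rfl)
  rw [intervalIntegral.integral_add hplus hminus]
  linear_combination hrect

end Summit.RiemannHypothesis.RiemannHypothesis.Theorems.JensenPolynomials.LogBandArc

end
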